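import Mathlib
import HarnessLib.Audit
import HarnessLib

/-!
# The numerator-free face of Zudilin's ζ(5)-only well-poised box: (8.9) verbatim, `ν_p ≤ 3`, and a
# Proposition-5 NO-GO at every height — cell `pub-zeta5`, class `vwp` (gen 6), target T4 (structural no-go)

HONEST FRAMING: systematic search; no irrationality claim unless certified. (Filed for `fam-vwp` g6 by the lead/lit g12 lane: mathematics byte-identical to the staged file sha256 4b1c436e…; one-line docstrings added on helper lemmas for the gate's docstring lint, nothing else changed.)  This file proves a NEGATIVE
(an envelope inequality for a whole face of a printed construction), not a candidate.

Provenance: family-designer seat `pub-zeta5-fam-vwp-g6` (planner role; staged under `run/shared/lean/pub/pub-zeta5/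
lean/fam-vwp/`, result of record `families/vwp/FAMILY.md` §13–§14) for VERBATIM filing by the lane.  Not literature.

## Source (PRINTED)
W. Zudilin, *Arithmetic of linear forms involving odd zeta values*, J. Théor. Nombres Bordeaux 16 (2004)
251–291 = arXiv:math/0206176, §8 [cite: Zudilin2004, §8: (8.6)–(8.9), Lemma 19, (8.13), Lemma 20, Prop. 5].
For odd `q ≥ r + 4` and positive integers `h = (h₀; h₁, …, h_q)`, `h₁ ≤ … ≤ h_q < h₀/2`, Lemma 19 gives
`D_{m₁}^r D_{m₂} ⋯ D_{m_{q−r}} · Φ(h)⁻¹ · F(h) ∈ ℤζ(q−2) + ⋯ + ℤζ(r+2) + ℤ` with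
`m₀ = max{h_r − 1, h₀ − 2h_{r+1}}`, `m_j = max{m₀, h₀ − h₁ − h_{r+j}}`, `Φ = ∏_{√h₀ < p ≤ m_{q−r}} p^{ν_p}`,
`ν_p = min_{h_{r+1} ≤ k ≤ h₀ − h_{r+1}} ν_{k,p}` and `ν_{k,p}` the floor-bracket sum (8.9).  With `r = 3`, `q = 7`
the forms lie in `ℚ + ℚζ(5)` — the only printed well-poised mechanism isolating `ζ(5)` in a single form.  Along
directions (8.13) `h₀ = η₀n + 2`, `h_j = η_jn + 1`, Proposition 5 reads: if `C₀ > C₂ = 3m₁ + m₂ + m₃ + m₄ − (Φ-saving)`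
(`C₀` = decay rate of `F`), then `ζ(5)` is irrational.  Zudilin reports (p. 22) that no direction with `η₀ ≤ 120`
satisfies it.

## Dictionary (scaled by `n`; the NUMERATOR-FREE FACE is `η₁ = η₂ = η₃ = 0`, i.e. `h₁ = h₂ = h₃ = 1` for all `n`)
* `FaceDir` : a face direction `(η₀; 0,0,0, a, b, c, d)`, reals `0 ≤ a ≤ b ≤ c ≤ d`, `2d < η₀`.
* `FaceDir.C0 D = Σ_{j=4}^{7} blockRate η₀ η_j`, `blockRate η₀ η = (η₀−η)log(η₀−η) − (η₀−2η)log(η₀−2η) − η log η`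
  — the decay rate `−lim (1/n) log F(h)` ON THE FACE (BOUNDARY LEMMA, ours and elementary: on the face `R(t) > 0`
  is log-convex on `t ≥ 0`, `F = ½ Σ_{t≥0} R″(t)` is a sum of positive terms squeezed against `R(0)`, then
  Stirling; FAMILY.md §13.1.  NOT formalised here — it is the meaning of `C0`, not a hypothesis of any theorem).
* `FaceDir.m1 … m4` : `m_j = max{η₃, η₀ − 2η₄, η₀ − η₁ − η_{3+j}}` (p. 20) with `η₁ = η₃ = 0`, `η₄..η₇ = a..d`;
  `FaceDir.delta D = 3m₁ + m₂ + m₃ + m₄` = the rate of Lemma 19's `D_{m₁}³ D_{m₂} D_{m₃} D_{m₄}`.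
* `FaceDir.phiBound D = 3·m₄` — an UPPER bound for the Φ-saving rate `φ = lim (1/n) log Φ(h)`: on the face
  `ν_p ≤ ν_{h₄,p} ≤ 3` for EVERY prime (`nuP_face_le_three`, exact over `ℤ`), so `Φ ≤ (∏_{p ≤ m₄} p)³`
  (`Phi_face_le`) and `φ ≤ 3m₄` by `θ(x) ∼ x` (PNT bookkeeping, on paper, as in the source).
## Results (all sorry-free)
* `nuKP`, `nuP`, `Phi` = (8.9) VERBATIM for `r = 3`, `q = 7` (`[x]` = floor = Euclidean `Int` division by `p > 0`);
  `ediv_add_carry`, `pairTerm_one` (pair summands vanish at `h_j = 1`), `brickTerm_le_one`, `nuKP_face_le_three`,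
  `nuP_face_le_three`, `nuKP_nonneg`, `Phi_face_le`, `Phi_face_le_pow` (Chebyshev: `Φ ≤ 4^{3m₄}`, unconditional).
* `FaceDir.face_envelope` : `C0 D ≤ (4 log 2 / 3)·(delta D − phiBound D)`; `four_log_two_div_three_lt_one`;
  hence `FaceDir.face_noGo` : `C0 D < delta D − φ` for every `φ ≤ phiBound D` — Proposition 5's hypothesis
  `C₀ > C₂` FAILS at EVERY face direction and EVERY height `η₀` (given the dictionary above), and so does the
  weaker requirement "the Lemma-19 forms tend to 0".  `FaceDir.face_kappa_le` : `κ := C0/(delta − phiBound) ≤ 0.9243`.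
* `FaceDir.face_envelope_phiFree` : `C0 D ≤ (2 log 2 / 3)·delta D`, with EQUALITY of both sides' ingredients at
  the symmetric direction `(3; 0,0,0, 1,1,1,1)` (`symmetricFace_C0 = 8 log 2`, `symmetricFace_delta = 12`): the
  Φ-free face constant is exactly `(2/3) log 2 = 0.46209…` (FAMILY.md §13.3 (c), previously MODEL); there also
  `face_envelope` holds with EQUALITY (`symmetricFace_envelope_eq`): all the slack to the MODEL `0.497` is in `φ ≤ 3m₄`.
## What is NOT proved here (paper / MODEL; FAMILY.md §13–§14)
(i) the boundary lemma `C₀ = C0` (ours, half a page); (ii) `φ ≤ 3m₄` from `ν_p ≤ 3` (PNT); (iii) that the face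
carries the supremum of `κ = C₀/(δ − φ)` over ALL directions of the `r = 3`, `q = 7` box (MODEL: `sup κ₇ ≈ 0.497`
at `(88; 0³, 24, 27, 30, 33)`, interior exhaustive for `η₀ ≤ 21` strictly below, ascents end on the boundary).
The proved constant `4 log 2 / 3 = 0.924…` is crude (MODEL `sup_face κ = 0.497`) but `< 1`, which is all a no-go
needs; the same argument gives `2 log 2 > 1` for the `q = 9, 11` faces, so it closes `q = 7` only.
-/

noncomputable section

open Real Finset

namespace Summit.KontsevichZagierPeriods.Zeta5Search

namespace WellPoisedFace

/-! ### 1. The block rate on the face and its entropy form -/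

/-- Rate of one pole block on the numerator-free face:
`g(η₀, η) = (η₀ − η) log(η₀ − η) − (η₀ − 2η) log(η₀ − 2η) − η log η`, the Stirling rate of
`(h₀ − 2h_j)! (h_j − 1)! / (h₀ − h_j)!` along `h₀ = η₀ n`, `h_j = η n` (FAMILY.md §13.1). -/
def blockRate (η₀ η : ℝ) : ℝ :=
  (η₀ - η) * log (η₀ - η) - (η₀ - 2 * η) * log (η₀ - 2 * η) - η * log η

/-- Entropy form of the block rate: `g(η₀, η) = (η₀ − η) · H(η/(η₀ − η))`, `H` = binary entropy in nats. -/
theorem blockRate_eq_binEntropy {η₀ η : ℝ} (hη : 0 ≤ η) (h2 : 2 * η < η₀) :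
    blockRate η₀ η = (η₀ - η) * binEntropy (η / (η₀ - η)) := by
  rcases hη.eq_or_lt with h0 | hpos
  · subst h0
    simp [blockRate]
  · have hu : 0 < η₀ - η := by linarith
    have hv : 0 < η₀ - 2 * η := by linarith
    have hu' : η₀ - η ≠ 0 := hu.ne'
    have h1 : 1 - η / (η₀ - η) = (η₀ - 2 * η) / (η₀ - η) := by
      field_simp
      ring
    rw [binEntropy, h1, inv_div, inv_div, Real.log_div hu' hpos.ne', Real.log_div hu' hv.ne']
    unfold blockRate
    field_simp
    ring

/-- `g(η₀, η) ≤ (η₀ − η) log 2` (binary entropy `≤ log 2`), for `0 ≤ η`, `2η < η₀`. -/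
theorem blockRate_le {η₀ η : ℝ} (hη : 0 ≤ η) (h2 : 2 * η < η₀) :
    blockRate η₀ η ≤ (η₀ - η) * log 2 := by
  rw [blockRate_eq_binEntropy hη h2]
  exact mul_le_mul_of_nonneg_left binEntropy_le_log_two (by linarith)

/-- `4 log 2 / 3 = 0.9241… < 1`. -/
theorem four_log_two_div_three_lt_one : 4 * log 2 / 3 < (1 : ℝ) := by
  have h := Real.log_two_lt_d9
  norm_num at h ⊢
  linarith

/-! ### 2. Face directions, Lemma-19 exponents on the face, the envelope and the no-go -/

/-- A direction on the numerator-free face of the `ζ(5)`-only box (`r = 3`, `q = 7`):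
`(η₀; η₁, …, η₇) = (η₀; 0, 0, 0, a, b, c, d)` with `0 ≤ a ≤ b ≤ c ≤ d` and `2d < η₀`
(the ordering `h₁ ≤ ⋯ ≤ h₇ < h₀/2` of [Zudilin2004, §8]). -/
structure FaceDir where
  /-- `η₀` -/
  η₀ : ℝ
  /-- `η₄` -/
  a : ℝ
  /-- `η₅` -/
  b : ℝ
  /-- `η₆` -/
  c : ℝ
  /-- `η₇` -/
  d : ℝ
  ha : 0 ≤ a
  hab : a ≤ b
  hbc : b ≤ c
  hcd : c ≤ d
  hd : 2 * d < η₀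

namespace FaceDir

variable (D : FaceDir)

/-- `C₀` on the face: the sum of the four block rates (its meaning — the decay rate of `F(h)` — is the
boundary lemma of FAMILY.md §13.1, not used as a hypothesis anywhere in this file). -/
def C0 : ℝ := blockRate D.η₀ D.a + blockRate D.η₀ D.b + blockRate D.η₀ D.c + blockRate D.η₀ D.d

/-- `m_j = max{η₃, η₀ − 2η₄, η₀ − η₁ − η_{3+j}}` [Zudilin2004, p. 20] on the face (`η₁ = η₃ = 0`, `η₄ = a`),
as a function of `x = η_{3+j}`. -/
def mOf (x : ℝ) : ℝ := max (max 0 (D.η₀ - 2 * D.a)) (D.η₀ - x)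

/-- `m₁` (for `η₄ = a`). -/ def m1 : ℝ := D.mOf D.a
/-- `m₂` (for `η₅ = b`). -/ def m2 : ℝ := D.mOf D.b
/-- `m₃` (for `η₆ = c`). -/ def m3 : ℝ := D.mOf D.c
/-- `m₄ = m_{q−r}` (for `η₇ = d`). -/ def m4 : ℝ := D.mOf D.d

/-- `δ = 3m₁ + m₂ + m₃ + m₄`: the exponential rate of Lemma 19's `D_{m₁}^3 D_{m₂} D_{m₃} D_{m₄}` (`r = 3`). -/
def delta : ℝ := 3 * D.m1 + D.m2 + D.m3 + D.m4

/-- `3·m₄`: upper bound for the `Φ`-saving rate on the face (`ν_p ≤ 3` for all primes `√h₀ < p ≤ m₄`,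
`nuP_face_le_three` below, plus `θ(x) ∼ x`). -/
def phiBound : ℝ := 3 * D.m4

/-- `0 < η₀ − a` for a face direction. -/ lemma η₀_sub_a_pos : 0 < D.η₀ - D.a := by linarith [D.ha, D.hab, D.hbc, D.hcd, D.hd]

/-- `m₁ = η₀ − a` (the largest of Zudilin's `m_j` on the face). -/ lemma m1_eq : D.m1 = D.η₀ - D.a := by
  unfold m1 mOf
  refine max_eq_right (max_le ?_ ?_) <;> linarith [D.ha, D.η₀_sub_a_pos]

/-- `η₀ − x ≤ mOf x`. -/ lemma mOf_ge (x : ℝ) : D.η₀ - x ≤ D.mOf x := le_max_right _ _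

/-- `mOf` is antitone. -/ lemma mOf_mono {x y : ℝ} (h : x ≤ y) : D.mOf y ≤ D.mOf x :=
  max_le_max le_rfl (by linarith)

/-- `m₄ ≤ m₂`. -/ lemma m4_le_m2 : D.m4 ≤ D.m2 := D.mOf_mono (D.hbc.trans D.hcd)

/-- `m₄ ≤ m₃`. -/ lemma m4_le_m3 : D.m4 ≤ D.m3 := D.mOf_mono D.hcd

/-- `C₀ ≤ log 2 · Σ_j (η₀ − η_j)` on the face (entropy bound, block by block). -/
theorem C0_le_sum : D.C0 ≤ log 2 * ((D.η₀ - D.a) + (D.η₀ - D.b) + (D.η₀ - D.c) + (D.η₀ - D.d)) := by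
  have h1 := blockRate_le (η₀ := D.η₀) D.ha (by linarith [D.hab, D.hbc, D.hcd, D.hd])
  have h2 := blockRate_le (η₀ := D.η₀) (D.ha.trans D.hab) (by linarith [D.hbc, D.hcd, D.hd])
  have h3 := blockRate_le (η₀ := D.η₀) (D.ha.trans (D.hab.trans D.hbc)) (by linarith [D.hcd, D.hd])
  have h4 := blockRate_le (η₀ := D.η₀) (D.ha.trans (D.hab.trans (D.hbc.trans D.hcd))) D.hd
  unfold C0
  linarith

/-- The net Lemma-19 exponent dominates three copies of `m₁`: `δ − 3m₄ ≥ 3m₁ = 3(η₀ − a)`. -/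
theorem three_m1_le : 3 * (D.η₀ - D.a) ≤ D.delta - D.phiBound := by
  have := D.m1_eq
  have := D.m4_le_m2
  have := D.m4_le_m3
  unfold delta phiBound
  linarith

/-- **FACE ENVELOPE (PROVED).** `C₀ ≤ (4 log 2 / 3) · (δ − 3m₄)` at every direction of the numerator-free face. -/
theorem face_envelope : D.C0 ≤ (4 * log 2 / 3) * (D.delta - D.phiBound) := by
  have hS := D.C0_le_sum
  have h3 := D.three_m1_le
  have hl : 0 < log 2 := Real.log_pos (by norm_num)
  have hmax : (D.η₀ - D.a) + (D.η₀ - D.b) + (D.η₀ - D.c) + (D.η₀ - D.d) ≤ 4 * (D.η₀ - D.a) := by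
    linarith [D.hab, D.hbc, D.hcd]
  nlinarith

/-- **NO-GO (PROVED, given the dictionary).** For any `Φ`-saving rate `φ ≤ 3m₄` — in particular the true one —
`C₀ < δ − φ`: Proposition 5's hypothesis `C₀ > C₂` fails on the whole face, at every height. -/
theorem face_noGo (φ : ℝ) (hφ : φ ≤ D.phiBound) : D.C0 < D.delta - φ := by
  have h1 := D.face_envelope
  have h2 := four_log_two_div_three_lt_one
  have h3 := D.three_m1_le
  have h4 := D.η₀_sub_a_pos
  have hpos : 0 < D.delta - D.phiBound := by linarith
  nlinarith

/-- The Proposition-5 ratio on the face: `κ = C₀/(δ − 3m₄) ≤ 4 log 2 / 3 = 0.9241…`. -/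
theorem face_kappa_le : D.C0 / (D.delta - D.phiBound) ≤ 4 * log 2 / 3 := by
  have hpos : 0 < D.delta - D.phiBound := by linarith [D.three_m1_le, D.η₀_sub_a_pos]
  rw [div_le_iff₀ hpos]
  exact D.face_envelope

/-- **Φ-FREE FACE ENVELOPE (PROVED).** `C₀ ≤ (2 log 2 / 3) · δ` (`δ ≥ (3/2) Σ_j (η₀ − η_j)`). -/
theorem face_envelope_phiFree : D.C0 ≤ (2 * log 2 / 3) * D.delta := by
  have hS := D.C0_le_sum
  have hl : 0 < log 2 := Real.log_pos (by norm_num)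
  have h1 := D.m1_eq
  have h2 := D.mOf_ge D.b
  have h3 := D.mOf_ge D.c
  have h4 := D.mOf_ge D.d
  have hδ : 3 * ((D.η₀ - D.a) + (D.η₀ - D.b) + (D.η₀ - D.c) + (D.η₀ - D.d)) ≤ 2 * D.delta := by
    unfold delta m2 m3 m4
    linarith [D.hab, D.hbc, D.hcd]
  nlinarith

/-- The symmetric face direction `(3; 0,0,0, 1,1,1,1)` = the classical symmetric pure-pole `ζ(5)` series
`h₀ = 3n + 2`, `h_j = n + 1`. -/
def symmetricFace : FaceDir where
  η₀ := 3
  a := 1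
  b := 1
  c := 1
  d := 1
  ha := by norm_num
  hab := le_rfl; hbc := le_rfl; hcd := le_rfl
  hd := by norm_num

/-- At the symmetric direction `C₀ = 8 log 2` … -/
theorem symmetricFace_C0 : symmetricFace.C0 = 8 * log 2 := by
  simp only [C0, blockRate, symmetricFace]
  norm_num
  ring

/-- … and `δ = 12`, so `C₀/δ = (2/3) log 2` exactly: the constant of `face_envelope_phiFree` is attained. -/
theorem symmetricFace_delta : symmetricFace.delta = 12 := by
  simp only [delta, m1, m2, m3, m4, mOf, symmetricFace]
  norm_num

/-- `face_envelope` is SHARP as an inequality in `C₀, δ, m₄`: equality at the symmetric direction (`3m₄ = 6`). -/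
theorem symmetricFace_envelope_eq :
    symmetricFace.C0 = (4 * log 2 / 3) * (symmetricFace.delta - symmetricFace.phiBound) := by
  rw [symmetricFace_C0, symmetricFace_delta, show symmetricFace.phiBound = 6 by
    simp only [phiBound, m4, mOf, symmetricFace]; norm_num]
  ring

end FaceDir

/-! ### 3. The integer arithmetic (8.9), verbatim for `r = 3`, `q = 7`, and `ν_p ≤ 3` on the face -/

/-- The floor carry: `[x/p] + [y/p] ≤ [(x+y)/p] ≤ [x/p] + [y/p] + 1` (`p > 0`; `/` = floor division on `ℤ`). -/
theorem ediv_add_carry (x y : ℤ) {p : ℤ} (hp : 0 < p) :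
    x / p + y / p ≤ (x + y) / p ∧ (x + y) / p ≤ x / p + y / p + 1 := by
  have key : x + y = (x % p + y % p) + (x / p + y / p) * p := by
    rw [Int.emod_def, Int.emod_def]; ring
  rw [key, Int.add_mul_ediv_right _ _ hp.ne']
  have h0 : 0 ≤ (x % p + y % p) / p :=
    Int.ediv_nonneg (add_nonneg (Int.emod_nonneg x hp.ne') (Int.emod_nonneg y hp.ne')) hp.le
  have h1 : (x % p + y % p) / p < 2 := by
    rw [Int.ediv_lt_iff_lt_mul hp]
    linarith [Int.emod_lt_of_pos x hp, Int.emod_lt_of_pos y hp]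
  constructor <;> linarith

/-- One `j ≤ r` summand of `ν_{k,p}` in (8.9):
`[(k−1)/p] + [(h₀−k−1)/p] − [(k−h_j)/p] − [(h₀−h_j−k)/p] − 2[(h_j−1)/p]`. -/
def pairTerm (h0 hj k p : ℤ) : ℤ :=
  (k - 1) / p + (h0 - k - 1) / p - (k - hj) / p - (h0 - hj - k) / p - 2 * ((hj - 1) / p)

/-- One `j > r` summand of `ν_{k,p}` in (8.9): `[(h₀−2h_j)/p] − [(k−h_j)/p] − [(h₀−h_j−k)/p]`. -/
def brickTerm (h0 hj k p : ℤ) : ℤ :=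
  (h0 - 2 * hj) / p - (k - hj) / p - (h0 - hj - k) / p

/-- `ν_{k,p}` of [Zudilin2004, (8.9)] for `r = 3`, `q = 7` and parameters `h = (h₀; h₁, …, h₇)`. -/
def nuKP (h0 h1 h2 h3 h4 h5 h6 h7 k p : ℤ) : ℤ :=
  pairTerm h0 h1 k p + pairTerm h0 h2 k p + pairTerm h0 h3 k p +
    (brickTerm h0 h4 k p + brickTerm h0 h5 k p + brickTerm h0 h6 k p + brickTerm h0 h7 k p)

/-- `ν_p = min_{h₄ ≤ k ≤ h₀−h₄} ν_{k,p}` of (8.9) (`r = 3`: the range starts at `h_{r+1} = h₄`); the value `0`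
in the degenerate case `h₄ > h₀ − h₄` is never used (the ordering has `2h₄ < h₀`). -/
def nuP (h0 h1 h2 h3 h4 h5 h6 h7 p : ℤ) : ℤ :=
  if h : h4 ≤ h0 - h4 then
    (Finset.Icc h4 (h0 - h4)).inf' (Finset.nonempty_Icc.2 h) fun k => nuKP h0 h1 h2 h3 h4 h5 h6 h7 k p
  else 0

/-- `m_{q−r} = m₄ = max{h₃ − 1, h₀ − 2h₄, h₀ − h₁ − h₇}` (unscaled, p. 19), the upper end of the prime range of `Φ`. -/
def mLast (h0 h1 h3 h4 h7 : ℤ) : ℤ := max (max (h3 - 1) (h0 - 2 * h4)) (h0 - h1 - h7)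

/-- `Φ(h) = ∏_{√h₀ < p ≤ m₄} p^{ν_p}` of (8.9) (`r = 3`, `q = 7`), primes as natural numbers
(`√h₀ < p ⇔ Nat.sqrt h₀ < p` for integers `p`). -/
def Phi (h0 h1 h2 h3 h4 h5 h6 h7 : ℤ) : ℕ :=
  ∏ p ∈ (Finset.Ioc (Nat.sqrt h0.toNat) (mLast h0 h1 h3 h4 h7).toNat).filter Nat.Prime,
    p ^ (nuP h0 h1 h2 h3 h4 h5 h6 h7 p).toNat

/-- On the face (`h_j = 1`) every pair summand of (8.9) vanishes identically. -/
theorem pairTerm_one (h0 k p : ℤ) : pairTerm h0 1 k p = 0 := by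
  have e : h0 - 1 - k = h0 - k - 1 := by ring
  simp only [pairTerm, sub_self, Int.zero_ediv, mul_zero, sub_zero, e]
  ring

/-- The brick summand of slot `j` vanishes at `k = h_j`. -/
theorem brickTerm_self (h0 hj p : ℤ) : brickTerm h0 hj hj p = 0 := by
  have e : h0 - hj - hj = h0 - 2 * hj := by ring
  simp only [brickTerm, sub_self, Int.zero_ediv, sub_zero, e]

/-- Each brick summand is `≤ 1` (`(h₀ − 2h_j) = (k − h_j) + (h₀ − h_j − k)`). -/
theorem brickTerm_le_one (h0 hj k : ℤ) {p : ℤ} (hp : 0 < p) : brickTerm h0 hj k p ≤ 1 := by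
  have h := (ediv_add_carry (k - hj) (h0 - hj - k) hp).2
  have e : k - hj + (h0 - hj - k) = h0 - 2 * hj := by ring
  rw [e] at h
  unfold brickTerm
  linarith

/-- Each brick summand is `≥ 0`. -/
theorem brickTerm_nonneg (h0 hj k : ℤ) {p : ℤ} (hp : 0 < p) : 0 ≤ brickTerm h0 hj k p := by
  have h := (ediv_add_carry (k - hj) (h0 - hj - k) hp).1
  have e : k - hj + (h0 - hj - k) = h0 - 2 * hj := by ring
  rw [e] at h
  unfold brickTerm
  linarith

/-- Each pair summand is `≥ 0`. -/
theorem pairTerm_nonneg (h0 hj k : ℤ) {p : ℤ} (hp : 0 < p) : 0 ≤ pairTerm h0 hj k p := by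
  have h1 := (ediv_add_carry (k - hj) (hj - 1) hp).1
  have h2 := (ediv_add_carry (h0 - hj - k) (hj - 1) hp).1
  have e1 : k - hj + (hj - 1) = k - 1 := by ring
  have e2 : h0 - hj - k + (hj - 1) = h0 - k - 1 := by ring
  rw [e1] at h1
  rw [e2] at h2
  unfold pairTerm
  linarith

/-- `ν_{k,p} ≥ 0` (so `Φ` is a genuine product of prime powers). -/
theorem nuKP_nonneg (h0 h1 h2 h3 h4 h5 h6 h7 k : ℤ) {p : ℤ} (hp : 0 < p) :
    0 ≤ nuKP h0 h1 h2 h3 h4 h5 h6 h7 k p := by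
  unfold nuKP
  have := pairTerm_nonneg h0 h1 k hp
  have := pairTerm_nonneg h0 h2 k hp
  have := pairTerm_nonneg h0 h3 k hp
  have := brickTerm_nonneg h0 h4 k hp
  have := brickTerm_nonneg h0 h5 k hp
  have := brickTerm_nonneg h0 h6 k hp
  have := brickTerm_nonneg h0 h7 k hp
  linarith

/-- **`ν_{h₄,p} ≤ 3` on the face** (`h₁ = h₂ = h₃ = 1`, `k = h₄`, any `h₀, h₄, …, h₇`, any `p > 0`). -/
theorem nuKP_face_le_three (h0 h4 h5 h6 h7 : ℤ) {p : ℤ} (hp : 0 < p) :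
    nuKP h0 1 1 1 h4 h5 h6 h7 h4 p ≤ 3 := by
  have h5' := brickTerm_le_one h0 h5 h4 hp
  have h6' := brickTerm_le_one h0 h6 h4 hp
  have h7' := brickTerm_le_one h0 h7 h4 hp
  simp only [nuKP, pairTerm_one, brickTerm_self]
  linarith

/-- **`ν_p ≤ 3` on the face** for every `p > 0` (in particular every prime `√h₀ < p ≤ m₄`), whenever the
range `h₄ ≤ k ≤ h₀ − h₄` of (8.9) is non-empty. -/
theorem nuP_face_le_three (h0 h4 h5 h6 h7 : ℤ) {p : ℤ} (hp : 0 < p) (h : h4 ≤ h0 - h4) :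
    nuP h0 1 1 1 h4 h5 h6 h7 p ≤ 3 := by
  rw [nuP, dif_pos h]
  exact (Finset.inf'_le _ (Finset.mem_Icc.2 ⟨le_rfl, h⟩)).trans (nuKP_face_le_three h0 h4 h5 h6 h7 hp)

/-- **`Φ ≤ (m₄#)³` on the face**: the prime-by-prime saving of Lemma 19 is at most the cube of a primorial. -/
theorem Phi_face_le (h0 h4 h5 h6 h7 : ℤ) (h : h4 ≤ h0 - h4) :
    Phi h0 1 1 1 h4 h5 h6 h7 ≤ (primorial (mLast h0 1 1 h4 h7).toNat) ^ 3 := by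
  unfold Phi
  set m := (mLast h0 1 1 h4 h7).toNat
  set S := (Finset.Ioc (Nat.sqrt h0.toNat) m).filter Nat.Prime with hS
  calc ∏ p ∈ S, p ^ (nuP h0 1 1 1 h4 h5 h6 h7 p).toNat ≤ ∏ p ∈ S, p ^ 3 := by
        apply Finset.prod_le_prod'
        intro p hp
        have hp' : p.Prime := (Finset.mem_filter.1 hp).2
        apply Nat.pow_le_pow_right hp'.pos
        exact Int.toNat_le.2 (nuP_face_le_three h0 h4 h5 h6 h7 (by exact_mod_cast hp'.pos) h)
    _ = (∏ p ∈ S, p) ^ 3 := Finset.prod_pow S 3 fun p => p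
    _ ≤ (primorial m) ^ 3 := by
        apply Nat.pow_le_pow_left
        unfold primorial
        apply Finset.prod_le_prod_of_subset_of_one_le'
        · intro p hp
          rw [hS, Finset.mem_filter, Finset.mem_Ioc] at hp
          exact Finset.mem_filter.2 ⟨Finset.mem_range.2 (Nat.lt_succ_of_le hp.1.2), hp.2⟩
        · intro p hp _
          exact (Finset.mem_filter.1 hp).2.one_lt.le

/-- Unconditional Chebyshev form: `Φ ≤ 4^{3m₄}` on the face (too weak for the no-go, which needs `θ(x) ∼ x`;
recorded because it is free). -/
theorem Phi_face_le_pow (h0 h4 h5 h6 h7 : ℤ) (h : h4 ≤ h0 - h4) :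
    Phi h0 1 1 1 h4 h5 h6 h7 ≤ 4 ^ (3 * (mLast h0 1 1 h4 h7).toNat) := by
  refine (Phi_face_le h0 h4 h5 h6 h7 h).trans ?_
  rw [mul_comm, pow_mul]
  exact Nat.pow_le_pow_left (primorial_le_four_pow _) 3

/-- Kernel instance (MODEL maximiser, `n = 1`: `h = (90; 1,1,1, 25,28,31,34)`, `p = 7`): `ν_{25,7} = 2`. -/
example : nuKP 90 1 1 1 25 28 31 34 25 7 = 2 := by decide

end WellPoisedFace

end Summit.KontsevichZagierPeriods.Zeta5Search
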